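import Mathlib
import Summits.Ventures.HodgeRepro2.T5AdicCompletionNormSurjective
import Summits.Ventures.HodgeRepro2.T5AdicCompletionConductor
import Summits.Ventures.HodgeRepro2.T5InertConductorShift

/-!
# The norm group of an inert quadratic extension of local fields has index 2, and the character
# trivial on norms is the unramified quadratic character

On Mathlib's completions `Kv ⊆ Lw` with `[Lw : Kv] = 2` and an inert uniformiser `ϖ`
(`T5AdicCompletionNormSurjective`'s setting), the NORM GROUP
`normGroup = {y ∈ Kvˣ | ∃ x ∈ Lw, x · σ x = y}` is described exactly:

* `mem_normGroup_iff_even`: `y` is a norm iff `log v(y)` is even — `⇒` by Galois invariance of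
  `v` (`v (x σ x) = v x ^ 2`), `⇐` by `N(O_{E_v}^×) = O_{F_v}^×`
  (`T5AdicCompletionNormSurjective`) and `ϖ^{2m} = N(ϖ^m)`;
* `index_normGroup_eq_two`: `[Kvˣ : N Lwˣ] = 2` (the local norm index theorem at an inert place);
* `mem_normGroup_of_val_eq_one`: units are norms, so every character of `Kvˣ` trivial on norms is
  UNRAMIFIED (`eq_one_of_val_eq_one`), and is determined by its value at `ϖ`, which squares to `1`
  (`apply_eq_zpow`, `sq_apply_uniformizer_eq_one`): «η_v is the unramified quadratic character at an
  inert place», the identification route/T5-route-2.md's Lemma N5.L4(ii) uses.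

Declaration per README §8(d): «uses an L-value-free non-vanishing device: NO».
-/

namespace Summit.Ventures.HodgeRepro2.T5AdicCompletionNormGroup

open IsDedekindDomain HeightOneSpectrum WithZero

variable {K : Type*} [Field K] [NumberField K] (v : HeightOneSpectrum (NumberField.RingOfIntegers K))
  {L : Type*} [Field L] [NumberField L] [Algebra K L]
  (w : HeightOneSpectrum (NumberField.RingOfIntegers L)) [w.asIdeal.LiesOver v.asIdeal]
  (σ : Gal(adicCompletion L w/adicCompletion K v))

/-- The norm group: the units `y` of `Kv` of the form `x · σ x` with `x ∈ Lw`. -/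
def normGroup : Subgroup (adicCompletion K v)ˣ where
  carrier := {y | ∃ x : adicCompletion L w,
    x * σ x = algebraMap (adicCompletion K v) (adicCompletion L w) (y : adicCompletion K v)}
  mul_mem' := by
    rintro a b ⟨x, hx⟩ ⟨y, hy⟩
    refine ⟨x * y, ?_⟩
    rw [Units.val_mul, map_mul (algebraMap (adicCompletion K v) (adicCompletion L w)), ← hx, ← hy,
      map_mul σ]
    ring
  one_mem' := ⟨1, by simp⟩
  inv_mem' := by
    rintro a ⟨x, hx⟩
    refine ⟨x⁻¹, ?_⟩
    rw [map_inv₀, Units.val_inv_eq_inv_val, map_inv₀, ← hx, mul_inv]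

/-- Membership in the norm group. -/
theorem mem_normGroup_iff (y : (adicCompletion K v)ˣ) :
    y ∈ normGroup v w σ ↔ ∃ x : adicCompletion L w,
      x * σ x = algebraMap (adicCompletion K v) (adicCompletion L w) (y : adicCompletion K v) :=
  Iff.rfl

/-- `v (x · σ x) = v x ^ 2` (Galois invariance of the valuation, row 82). -/
theorem val_mul_algEquiv (x : adicCompletion L w) : Valued.v (x * σ x) = Valued.v x ^ 2 := by
  rw [map_mul, T5AdicCompletionGaloisInvariance.val_algEquiv_apply v w σ, sq]

variable (h2 : Module.finrank (adicCompletion K v) (adicCompletion L w) = 2)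
  {ϖ : adicCompletionIntegers K v} (hϖ : Irreducible ϖ)
  (hϖS : Irreducible (algebraMap (adicCompletionIntegers K v) (adicCompletionIntegers L w) ϖ))
  (hσ : σ ≠ 1)

include hϖ in
/-- `v ϖ = exp (−1)` in `Kv`. -/
theorem val_uniformizer : Valued.v (ϖ : adicCompletion K v) = exp (-1) :=
  (T5AdicCompletionConductor.irreducible_iff_val_eq_exp_neg_one v ϖ).mp hϖ

include hϖ hϖS in
/-- A norm has even valuation exponent. -/
theorem even_log_val_of_mem_normGroup {y : (adicCompletion K v)ˣ} (hy : y ∈ normGroup v w σ) :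
    Even (Valued.v (y : adicCompletion K v)).log := by
  obtain ⟨x, hx⟩ := hy
  have hx0 : x ≠ 0 := by
    rintro rfl
    rw [zero_mul] at hx
    exact (map_ne_zero _).mpr y.ne_zero hx.symm
  have h := congrArg Valued.v hx
  rw [val_mul_algEquiv v w σ, T5InertConductorShift.val_algebraMap_eq v w hϖ hϖS] at h
  rw [← h, log_pow]
  exact ⟨(Valued.v x).log, by rw [two_nsmul]⟩

include h2 hϖ hϖS hσ in
/-- An element of even valuation exponent is a norm (`N(O_{E_v}^×) = O_{F_v}^×` plus
`ϖ^{2m} = N(ϖ^m)`). -/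
theorem mem_normGroup_of_even_log_val {y : (adicCompletion K v)ˣ}
    (hy : Even (Valued.v (y : adicCompletion K v)).log) : y ∈ normGroup v w σ := by
  obtain ⟨m, hm⟩ := hy
  obtain ⟨u, hu1, hu⟩ := T5UnramifiedCharacter.exists_val_eq_one_mul_zpow (val_uniformizer v hϖ)
    (y.ne_zero)
  have humem : u ∈ adicCompletionIntegers K v := (mem_adicCompletionIntegers _ _ _).mpr hu1.le
  have huunit : IsUnit (⟨u, humem⟩ : adicCompletionIntegers K v) := by
    rw [← IsLocalRing.notMem_maximalIdeal, T5AdicCompletionResidueField.mem_maximalIdeal_iff]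
    simp [hu1]
  obtain ⟨x₀, -, hx₀⟩ := T5AdicCompletionNormSurjective.exists_val_eq_one_mul_algEquiv_eq v w h2 hϖ hϖS
    σ hσ ⟨u, humem⟩ huunit
  refine ⟨x₀ * algebraMap (adicCompletion K v) (adicCompletion L w) (ϖ : adicCompletion K v) ^ (-m), ?_⟩
  have hfix : σ (algebraMap (adicCompletion K v) (adicCompletion L w) (ϖ : adicCompletion K v)) =
      algebraMap (adicCompletion K v) (adicCompletion L w) (ϖ : adicCompletion K v) :=
    σ.commutes _
  have hx₀' : x₀ * σ x₀ = algebraMap (adicCompletion K v) (adicCompletion L w) u := hx₀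
  have hP0 : algebraMap (adicCompletion K v) (adicCompletion L w) (ϖ : adicCompletion K v) ≠ 0 :=
    (map_ne_zero _).mpr (by exact_mod_cast hϖ.ne_zero)
  rw [map_mul σ, map_zpow₀ σ, hfix, hu, hm, map_mul, map_zpow₀, ← hx₀', neg_add, zpow_add₀ hP0]
  ring

include h2 hϖ hϖS hσ in
/-- THE NORM GROUP AT AN INERT PLACE: `y` is a norm iff `log v(y)` is even. -/
theorem mem_normGroup_iff_even (y : (adicCompletion K v)ˣ) :
    y ∈ normGroup v w σ ↔ Even (Valued.v (y : adicCompletion K v)).log :=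
  ⟨even_log_val_of_mem_normGroup v w σ hϖ hϖS, mem_normGroup_of_even_log_val v w σ h2 hϖ hϖS hσ⟩

include h2 hϖ hϖS hσ in
/-- Units of `O_Kv` are norms. -/
theorem mem_normGroup_of_val_eq_one {y : (adicCompletion K v)ˣ}
    (hy : Valued.v (y : adicCompletion K v) = 1) : y ∈ normGroup v w σ := by
  rw [mem_normGroup_iff_even v w σ h2 hϖ hϖS hσ, hy]
  simp

/-- The uniformiser `ϖ` as a unit of `Kv`. -/
noncomputable def uniformizerUnit (hϖ : Irreducible ϖ) : (adicCompletion K v)ˣ :=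
  Units.mk0 (ϖ : adicCompletion K v) (by exact_mod_cast hϖ.ne_zero)

/-- The value of `uniformizerUnit`. -/
theorem coe_uniformizerUnit (hϖ : Irreducible ϖ) :
    ((uniformizerUnit v hϖ : (adicCompletion K v)ˣ) : adicCompletion K v) = (ϖ : adicCompletion K v) :=
  rfl

include h2 hϖ hϖS hσ in
/-- THE LOCAL NORM INDEX THEOREM AT AN INERT PLACE: `[Kvˣ : N Lwˣ] = 2`. -/
theorem index_normGroup_eq_two : (normGroup v w σ).index = 2 := by
  rw [Subgroup.index_eq_two_iff]
  refine ⟨uniformizerUnit v hϖ, fun b => ?_⟩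
  rw [mem_normGroup_iff_even v w σ h2 hϖ hϖS hσ, mem_normGroup_iff_even v w σ h2 hϖ hϖS hσ,
    Units.val_mul, map_mul, log_mul ((Valuation.ne_zero_iff _).mpr b.ne_zero)]
  · rw [coe_uniformizerUnit, val_uniformizer v hϖ, log_exp]
    rcases Int.even_or_odd (Valued.v (b : adicCompletion K v)).log with h | h
    · right
      refine ⟨h, ?_⟩
      rw [Int.not_even_iff_odd, ← sub_eq_add_neg]
      exact h.sub_odd odd_one
    · left
      refine ⟨?_, ?_⟩
      · rw [← sub_eq_add_neg]; exact h.sub_odd odd_one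
      · rw [Int.not_even_iff_odd]; exact h
  · exact (Valuation.ne_zero_iff _).mpr (uniformizerUnit v hϖ).ne_zero

section Character

variable {M : Type*} [CommGroup M] (η : (adicCompletion K v)ˣ →* M)
  (hη : ∀ y ∈ normGroup v w σ, η y = 1)

include h2 hϖ hϖS hσ hη in
/-- A character of `Kvˣ` trivial on norms is UNRAMIFIED (trivial on `O_Kv^×`). -/
theorem eq_one_of_val_eq_one {y : (adicCompletion K v)ˣ}
    (hy : Valued.v (y : adicCompletion K v) = 1) : η y = 1 :=
  hη y (mem_normGroup_of_val_eq_one v w σ h2 hϖ hϖS hσ hy)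

include h2 hϖ hϖS hσ hη in
/-- A character of `Kvˣ` trivial on norms is `y ↦ η(ϖ)^{−log v(y)}` (row 81's unramified shape). -/
theorem apply_eq_zpow (y : (adicCompletion K v)ˣ) :
    η y = η (uniformizerUnit v hϖ) ^ (-(Valued.v (y : adicCompletion K v)).log) :=
  T5UnramifiedCharacter.apply_eq_zpow η (fun u hu => eq_one_of_val_eq_one v w σ h2 hϖ hϖS hσ η hη hu)
    (by rw [coe_uniformizerUnit]; exact val_uniformizer v hϖ) y

include h2 hϖ hϖS hσ hη in
/-- A character of `Kvˣ` trivial on norms has `η(ϖ)² = 1` (`ϖ² = N ϖ`). -/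
theorem sq_apply_uniformizer_eq_one : η (uniformizerUnit v hϖ) ^ 2 = 1 := by
  rw [← map_pow]
  apply hη
  rw [mem_normGroup_iff_even v w σ h2 hϖ hϖS hσ, Units.val_pow_eq_pow_val, map_pow, log_pow,
    coe_uniformizerUnit, val_uniformizer v hϖ, log_exp]
  exact ⟨-1, by rw [two_nsmul]⟩

end Character

end Summit.Ventures.HodgeRepro2.T5AdicCompletionNormGroup
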